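/-
Origin: expansion seat `planner-pub-hodgecm-pv14-g4-0`, handover #3 2026-08-18T08:50:03Z (`HOME/pub-hodgecm-pv14-g4/lean/Pv14g4/WeilThetaModelPoisson.lean`, md5 f0a13484, 174 lines);
landed by the gen-7 packager in gate run 27 as `HodgeCM/Automorphic/WeilThetaModelPoisson.lean` (import ^import Pv14g4\.→import HodgeCM.Automorphic. ×1).
-/
/-
Origin: HOME/pub-hodgecm-pv14-g4/lean/Pv14g4/WeilThetaModelPoisson.lean — session planner-pub-hodgecm-pv14-g4-0
(unit pub-hodgecm-pv14-g4, DAG-node prover #14 gen 4).  Intended final place: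
`HodgeCM/Automorphic/WeilThetaModelPoisson.lean` (namespace `HodgeCM.SchwartzWeil`).
Imports this seat's `WeilThetaModelSchrodinger` (PACKAGER: rewrite `import Pv14g4.WeilThetaModelSchrodinger` to
`import HodgeCM.Automorphic.WeilThetaModelSchrodinger`) and Mathlib only; asserts nothing (no `axiom`, no
new constants other than the abbreviation `intLattice` and the equivalence `intLatticeEquiv`).
-/
import Summits.HodgeConjecture.HodgeCM.Automorphic.WeilThetaModelSchrodinger
import Mathlib.Analysis.Fourier.PoissonSummation

/-!
# The Weyl element at the real place: Poisson summation in the Schrödinger–lattice model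

Weil 1964 (Acta Math. 111), n° 41, formula (39), p. 193: `Σ_{ξ ∈ X_k} Φ(ξ) = Σ_{ξ ∈ X_k} (r_k(s) Φ)(ξ)` for
`s ∈ Ps(X)_k`, "égalité qui ... se réduit à la formule de Poisson lorsque `s = d'(γ)`" (the Weyl element).
This file records the kernel form of that remark in the one honest archimedean model the package has
(`HodgeCM.SchwartzWeil.schrodingerModel`, pv14-g4 #2): for `X = ℚ`, `X_∞ = ℝ`, `X_k ∩` (unit adèles) `= ℤ`,
the theta distribution `Θ(·)(1) : Φ ↦ Σ_{n ∈ ℤ} Φ(n)` on `𝓢(ℝ, ℂ)` (the Dirac comb, `SchwartzWeil.thetaCLM`)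
is invariant under the Fourier transform `𝓕 : 𝓢(ℝ, ℂ) →L[ℂ] 𝓢(ℝ, ℂ)` — Mathlib's Poisson summation
`SchwartzMap.tsum_eq_tsum_fourier` at `x = 0`.

Main statements (all THEOREMS from Mathlib; nothing cited, nothing posited):
* `intLattice` — the lattice `ℤ ⊂ ℝ` as a `Submodule ℤ ℝ` (`= span ℤ (range (Basis.singleton))`, so that
  Mathlib's `DiscreteTopology` / `IsZLattice ℝ` instances apply); `mem_intLattice`, `intLatticeEquiv : ℤ ≃ intLattice`,
  `tsum_intLattice : ∑' v : intLattice, g v = ∑' n : ℤ, g n`.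
* `tsum_fourier_intCast : ∑' n : ℤ, (𝓕 Φ) n = ∑' n : ℤ, Φ n` — Poisson summation at `x = 0`.
* `thetaCLM_fourier : thetaCLM intLattice 0 (𝓕 Φ) = thetaCLM intLattice 0 Φ` — the comb (`SchwartzWeil.thetaCLM`,
  pv14-g4 #1) is `𝓕`-invariant.
* `theta_fourier_one : theta ℝ intLattice m (𝓕 Φ) 1 = theta ℝ intLattice m Φ 1` — Weil's (39) for the Weyl
  element, at `S = 1`, in the model's own theta function (`SchwartzWeil.theta`, pv14-g4 #2).
* `datum_theta_fourier_one` — the same through the `WeilThetaDatum` record `SchwartzWeil.datum ℝ intLattice m`;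
  `schrodingerModel_θ_fourier_one` — the same through prl1-g4's `WeilThetaModel` record
  (`θ_{𝓕Φ}(1·ℤ, 1·Γ) = θ_Φ(1·ℤ, 1·Γ)` for `schrodingerModel ℝ intLattice m Γ hΓ`).
* `fourier_fourier_apply : 𝓕 (𝓕 Φ) y = Φ (-y)`, `tsum_fourier_translate : Σ_n (𝓕Φ)(x + n) = Σ_n Φ(-n) e(n x)`,
  `theta_fourier : theta ℝ intLattice m (𝓕 Φ) (a, u) = u^m · Σ_n Φ(-n) e(-n a)` — away from the base point the
  Weyl element turns the translation `a` into the character `n ↦ e(n a)` (theta-level shadow only).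

LABELS.  Every statement here is KERNEL (Mathlib).  What is NOT claimed: the Weyl element is not adjoined to the
model's group `Mp := ℝ × U(1)` (no metaplectic cocycle is built; GAPS pv14g4-K1), so this is invariance of the
distribution `Θ(·)(1)` under one further operator of `𝓢(ℝ, ℂ)`, not an enlargement of `WeilThetaModel.rat`;
dimension one only (Mathlib's Poisson summation is over `ℤ ⊂ ℝ`).
-/

noncomputable section

open scoped SchwartzMap FourierTransform

namespace HodgeCM.SchwartzWeil

open Literature.Theta

/-! ## 1. The lattice `ℤ ⊂ ℝ` as a `Submodule ℤ ℝ` -/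

/-- `ℤ ⊂ ℝ`, written as the `ℤ`-span of the one-element real basis so that Mathlib's `ZSpan` instances
(`DiscreteTopology`, `IsZLattice ℝ`) are found by unification. -/
abbrev intLattice : Submodule ℤ ℝ :=
  Submodule.span ℤ (Set.range (Module.Basis.singleton Unit ℝ))

/-- (Ported verbatim from the HodgeCMPerL package; no docstring in the source.) -/
theorem range_basisSingleton : Set.range (Module.Basis.singleton Unit ℝ) = {1} := by
  ext x
  simp

/-- (Ported verbatim from the HodgeCMPerL package; no docstring in the source.) -/
theorem mem_intLattice {x : ℝ} : x ∈ intLattice ↔ ∃ n : ℤ, (n : ℝ) = x := by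
  rw [intLattice, range_basisSingleton, Submodule.mem_span_singleton]
  simp [zsmul_eq_mul]

/-- (Ported verbatim from the HodgeCMPerL package; no docstring in the source.) -/
theorem intCast_mem_intLattice (n : ℤ) : (n : ℝ) ∈ intLattice := mem_intLattice.mpr ⟨n, rfl⟩

example : DiscreteTopology intLattice := inferInstance
example : IsZLattice ℝ intLattice := inferInstance

/-- `ℤ ≃ intLattice`, `n ↦ n`. -/
def intLatticeEquiv : ℤ ≃ intLattice where
  toFun n := ⟨(n : ℝ), intCast_mem_intLattice n⟩
  invFun v := (mem_intLattice.mp v.2).choose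
  left_inv n := by
    apply Int.cast_injective (α := ℝ)
    exact (mem_intLattice.mp (intCast_mem_intLattice n)).choose_spec
  right_inv v := by
    ext
    exact (mem_intLattice.mp v.2).choose_spec

/-- (Ported verbatim from the HodgeCMPerL package; no docstring in the source.) -/
@[simp] theorem coe_intLatticeEquiv (n : ℤ) : ((intLatticeEquiv n : intLattice) : ℝ) = n := rfl

/-- Sums over `intLattice` are sums over `ℤ`. -/
theorem tsum_intLattice {F : Type*} [AddCommMonoid F] [TopologicalSpace F] (g : ℝ → F) :
    ∑' v : intLattice, g (v : ℝ) = ∑' n : ℤ, g n := by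
  rw [← intLatticeEquiv.tsum_eq]
  rfl

/-! ## 2. The Dirac comb is Fourier-invariant (Poisson summation) -/

/-- **Poisson summation at `x = 0`**: `Σ_{n ∈ ℤ} (𝓕 Φ)(n) = Σ_{n ∈ ℤ} Φ(n)` (Mathlib `SchwartzMap.tsum_eq_tsum_fourier`,
the characters `fourier n` evaluated at `0 ∈ ℝ/ℤ` being `1`). -/
theorem tsum_fourier_intCast (Φ : 𝓢(ℝ, ℂ)) :
    ∑' n : ℤ, (𝓕 Φ) (n : ℝ) = ∑' n : ℤ, Φ (n : ℝ) := by
  have hP := SchwartzMap.tsum_eq_tsum_fourier Φ 0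
  simp only [zero_add, QuotientAddGroup.mk_zero, fourier_eval_zero, mul_one] at hP
  exact hP.symm

/-- **Poisson summation, distribution form**: `Θ(𝓕 Φ)(1) = Θ(Φ)(1)`, i.e. the theta distribution
`thetaCLM ℤ 0 = Σ_{n ∈ ℤ} δ_n` on `𝓢(ℝ, ℂ)` is invariant under the Fourier transform
(Weil 1964 (39) for the Weyl element `s = d'(γ)`, p. 193). -/
theorem thetaCLM_fourier (Φ : 𝓢(ℝ, ℂ)) :
    thetaCLM intLattice (0 : ℝ) (𝓕 Φ) = thetaCLM intLattice (0 : ℝ) Φ := by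
  simp only [thetaCLM_apply, zero_add]
  rw [tsum_intLattice, tsum_intLattice]
  exact tsum_fourier_intCast Φ

/-! ## 3. In the Schrödinger–lattice model: `Θ_{𝓕 Φ}(1) = Θ_Φ(1)` -/

/-- **Weil's (39) for the Weyl element, in the model**: for every weight `m`, the model's theta function
(`SchwartzWeil.theta ℝ ℤ m`, pv14-g4 #2) satisfies `Θ_{𝓕 Φ}(1) = Θ_Φ(1)`. -/
theorem theta_fourier_one (m : ℤ) (Φ : 𝓢(ℝ, ℂ)) :
    theta ℝ intLattice m (𝓕 Φ) 1 = theta ℝ intLattice m Φ 1 := by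
  rw [theta_eq_thetaCLM, theta_eq_thetaCLM, act_one, act_one, thetaCLM_fourier]

/-- The same statement read through the `WeilThetaDatum` record of the model (`SchwartzWeil.datum ℝ ℤ m`;
`SX = 𝓢(ℝ, ℂ)`, `theta = SchwartzWeil.theta`). -/
theorem datum_theta_fourier_one (m : ℤ) (Φ : 𝓢(ℝ, ℂ)) :
    (datum ℝ intLattice m).theta (𝓕 Φ) 1 = (datum ℝ intLattice m).theta Φ 1 :=
  theta_fourier_one m Φ

/-- And through prl1-g4's `WeilThetaModel` record (`schrodingerModel ℝ ℤ m Γ hΓ`, `SK = univ`): the model's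
adelic-style theta kernel `θ` at the base point agrees on `Φ` and `𝓕 Φ`:
`θ_{𝓕Φ}(1·ℤ, 1·Γ) = θ_Φ(1·ℤ, 1·Γ)`. -/
theorem schrodingerModel_θ_fourier_one (m : ℤ) (Γ : Subgroup Circle) (hΓ : ∀ u ∈ Γ, u ^ m = 1)
    (Φ : 𝓢(ℝ, ℂ)) :
    (schrodingerModel ℝ intLattice m Γ hΓ).θ ⟨𝓕 Φ, Set.mem_univ _⟩
        (QuotientGroup.mk (1 : Multiplicative ℝ), QuotientGroup.mk (1 : Circle)) =
      (schrodingerModel ℝ intLattice m Γ hΓ).θ ⟨Φ, Set.mem_univ _⟩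
        (QuotientGroup.mk (1 : Multiplicative ℝ), QuotientGroup.mk (1 : Circle)) := by
  rw [schrodingerModel_θ_mk, schrodingerModel_θ_mk]
  congr 1
  simp only [toAdd_one, zero_add]
  rw [tsum_intLattice, tsum_intLattice]
  exact tsum_fourier_intCast Φ

/-! ## 4. The Weyl element turns translations into characters: `Θ_{𝓕Φ}(a, u)` in closed form -/

/-- `𝓕 (𝓕 Φ) (y) = Φ (-y)` for Schwartz `Φ` on `ℝ` (Fourier inversion: Mathlib's `FourierPair` instance on
`𝓢(ℝ, ℂ)` and `𝓕⁻ f = (𝓕 f) ∘ neg`). -/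
theorem fourier_fourier_apply (Φ : 𝓢(ℝ, ℂ)) (y : ℝ) : (𝓕 (𝓕 Φ)) y = Φ (-y) := by
  have h : (𝓕⁻ (𝓕 Φ)) (-y) = (𝓕 (𝓕 Φ)) y := by
    rw [SchwartzMap.fourierInv_apply_eq]
    simp
  rw [← h, FourierTransform.fourierInv_fourier_eq]

/-- **Poisson summation with a shift, applied to `𝓕 Φ`**: `Σ_{n ∈ ℤ} (𝓕Φ)(x + n) = Σ_{n ∈ ℤ} Φ(-n) e(n x)`. -/
theorem tsum_fourier_translate (Φ : 𝓢(ℝ, ℂ)) (x : ℝ) :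
    ∑' n : ℤ, (𝓕 Φ) (x + n) = ∑' n : ℤ, Φ (-(n : ℝ)) * fourier n (x : UnitAddCircle) := by
  rw [SchwartzMap.tsum_eq_tsum_fourier (𝓕 Φ) x]
  exact tsum_congr fun n => by rw [fourier_fourier_apply]

/-- **`Θ_{𝓕Φ}(a, u) = u^m · Σ_{n ∈ ℤ} Φ(-n) e(-n a)`** (`= u^m Σ_{n ∈ ℤ} e(n a) Φ(n)`): at a translation `a ∈ ℝ = X_∞`
the model theta function of `𝓕 Φ` is the lattice sum of `Φ` twisted by the character `n ↦ e(n a)` — the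
theta-level shadow of "the Weyl element conjugates translations into the dual characters" (Weil 1964 n° 41 (39)
with `s = d'(γ)` composed with a translation; only the shadow: the characters are not operators of the model). -/
theorem theta_fourier (m : ℤ) (Φ : 𝓢(ℝ, ℂ)) (a : ℝ) (u : Circle) :
    theta ℝ intLattice m (𝓕 Φ) (Multiplicative.ofAdd a, u) =
      ((u : ℂ) ^ m) * ∑' n : ℤ, Φ (-(n : ℝ)) * fourier n ((-a : ℝ) : UnitAddCircle) := by
  rw [theta_eq]
  congr 1
  simp only [toAdd_ofAdd]
  have hL : (∑' v : intLattice, (𝓕 Φ : 𝓢(ℝ, ℂ)) (-a + (v : ℝ))) =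
      ∑' n : ℤ, (𝓕 Φ : 𝓢(ℝ, ℂ)) (-a + n) :=
    tsum_intLattice (fun y => (𝓕 Φ : 𝓢(ℝ, ℂ)) (-a + y))
  rw [hL]
  exact tsum_fourier_translate Φ (-a)

end HodgeCM.SchwartzWeil

end
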